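import Literature.Barriers.CriticalPhenomena.WeaklySAWFlowMapDeriv
import Literature.Barriers.CriticalPhenomena.WeaklySAWFlowTheorem
import Literature.Barriers.CriticalPhenomena.WeaklySAWFlowHomogeneousMode
import Literature.Barriers.CriticalPhenomena.WeaklySAWFixedPointCalculus
import HarnessLib

/-!
# [BBS-rg-flow, Theorem 1.4(ii), §3.4 recast]: the affine family `T̃_p ỹ = Tỹ + p·e` of flow maps,
# its fixed points (the flows with `g`-initial value `g̊₀ + p`), and their strict differentiability in `p`

File of the series formalising [BBS-rg-flow] (Bauerschmidt–Brydges–Slade, AHP 16 (2015),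
arXiv:1211.2477) towards `Literature.Barriers.CriticalPhenomena.WeaklySAWFourDimLogCorrections`, for
Theorem 1.4(ii) (= BBS 2015, Theorem 7.2.1(ii)); continuation of `WeaklySAWFlowMapDeriv.lean`
(`T` is strictly differentiable on the open unit ball, `‖DT‖ ≤ θ`), `WeaklySAWFlowTheorem.lean`
(a flow with the bounds scales back to a fixed point), `WeaklySAWFlowHomogeneousMode.lean` (the scaled
homogeneous mode `e`, `‖e‖ ≤ K_e/(𝗁g̊₀²|log g̊₀|)`) and `WeaklySAWFixedPointCalculus.lean` (strict
differentiability of the fixed point of a parametrised contraction).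

The road (documented deviation from §3.4 of the source, same mechanism): the source differentiates the
time-one map of the ODE `ẏ = F(t, x̊ + y)` in the initial condition ([AM78] + Gronwall, (3.x) "ydu").
Here, at a base point `g̊₀` with its reference flow `x̊ = x̄(g̊₀)`, weights and solution operator `S̄`
all FROZEN, the flow with `g`-initial value `g̊₀ + p` is, in the scaled coordinates around `x̊`, exactly
the fixed point of the AFFINE family `T̃_p ỹ = Tỹ + p·E`, `E = (0, e)` with `e` the scaled homogeneous
mode of the linearised `𝒱`-equations (`g`-initial value `1/𝗐_{g,0}·𝗐_{g,0} = 1`, `(z, μ)_∞ = 0`):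
* `modeVec` (`E`), `Ttil` (`T̃_p`), `MarginHyp` (the smallness of the contraction at level `β` WITH a
  margin `m`: `‖S‖M/𝗁 + θβ + m ≤ β`); for `|p|‖E‖ ≤ m`, `T̃_p` is a `θ`-contraction of the ball
  `scaledBall β` (`mapsTo_Ttil`, `lipschitzOnWith_Ttil`), with a unique fixed point `affFix p`
  (`affFix_spec`, `affFix_unique`), Lipschitz in `p` (`norm_affFix_sub_le`) and, for `|p|‖E‖ < m`,
  strictly inside the ball (`norm_affFix_lt`);
* **`hasStrictDerivAt_affFix`**: for `|p|‖E‖ < m` (and `β < 1`), `p ↦ affFix p` is strictly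
  differentiable, its derivative `v` solves `v = DT(ỹ)v + E` and obeys `‖v‖ ≤ ‖E‖/(1 - θ)` — the bound
  `‖D_{g₀}y‖_{X^𝗐} ≤ C‖D_{g₀}x̄‖_{X^𝗐} ≤ O(g̊₀⁻²|log g̊₀|⁻¹)` ("ydu") of the printed proof;
* **`Ttil_eq_of_flow`**: a flow of `Φ` with `K₀` prescribed, `g`-initial value `g̊₀ + p`, `(z_j, μ_j) → 0`,
  whose scaled-back coordinates lie in the ball, IS a fixed point of `T̃_p` (the `𝒦`-row directly; the
  `𝒱`-rows by uniqueness of the linear problem after subtracting `p` times the homogeneous mode: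
  `π_{j+1} = a_jπ_j`, `Zᵉ_{j+1} = (1-ζ_jg̊_j)Zᵉ_j - ξ̃_jπ_j`, `Mᵉ_{j+1} = λ̃_jMᵉ_j + η̃_jπ_j + γ̃_jZᵉ_j`).

## References
* R. Bauerschmidt, D. C. Brydges, G. Slade, *Structural stability of a dynamical system near a
  non-hyperbolic fixed point*, Ann. Henri Poincaré 16 (2015), arXiv:1211.2477: Theorem 1.4(ii) and its
  proof (§3.4), Lemma 3.4 (3.15), Lemma 2.3 (2.35)–(2.40), Lemma 4.2. [BauerschmidtBrydgesSlade2015Flow]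
* R. Bauerschmidt, D. C. Brydges, G. Slade, CMP 338 (2015), arXiv:1403.7422, Theorem 7.2.1(ii).
  [BauerschmidtBrydgesSlade2015LogCorr]
-/

noncomputable section

open Filter Topology Set
open scoped BigOperators ENNReal NNReal

namespace Literature.Barriers.CriticalPhenomena

namespace CTWSAW

/-! ## The direction `E = (0, e)` and the affine family `T̃_p ỹ = Tỹ + p·E` -/

section AffineDefs

variable (W : ℕ → Type*) [∀ j, NormedAddCommGroup (W j)] [∀ j, NormedSpace ℝ (W j)]

/-- The direction `E = (0, e) ∈ ℓ^∞(∏𝒲_j) × ℓ^∞(ℝ³)`, `e` the scaled homogeneous mode `modeV`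
(`= 𝗐⁻¹·∂V̄/∂g₀`). [cite: BauerschmidtBrydgesSlade2015Flow, Lemma 3.4, (3.15) and Lemma 2.3, (2.35)–(2.40)] -/
def modeVec (P : QuadFlowParams) (Ω : ℝ) (k : ℕ∞) (g₀ hh : ℝ) : SeqK W × SeqV :=
  (0, toSeqV (P.modeV g₀ Ω k hh))

variable {W}

/-- **The affine family of flow maps** `T̃_p ỹ = Tỹ + p·E`: its fixed points in the ball are the flows
of `Φ` with `g`-initial value `g̊₀ + p` (and `K₀`, `(z, μ)_∞ = 0` as before), in the scaled coordinates
around the frozen reference flow `x̄(g̊₀)`. [cite: BauerschmidtBrydgesSlade2015Flow, Theorem 1.4(ii) (proof, §3.4: the flow as a function of the initial condition)] -/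
def Ttil (P : QuadFlowParams) (ψ : ∀ j, W j × V3 → W (j + 1)) (ρ : ∀ j, W j × V3 → V3) (Ω : ℝ) (k : ℕ∞)
    (g₀ hh aK : ℝ) (K₀ : W 0) (S : SeqV →L[ℝ] SeqV) (p : ℝ) (y : SeqK W × SeqV) : SeqK W × SeqV :=
  Tmap P ψ ρ Ω k g₀ hh aK K₀ S y + p • modeVec W P Ω k g₀ hh

omit [∀ j, NormedSpace ℝ (W j)] in
/-- `(E)^K = 0`. [cite: BauerschmidtBrydgesSlade2015Flow, Lemma 3.4] -/
@[simp] theorem modeVec_fst (P : QuadFlowParams) (Ω : ℝ) (k : ℕ∞) (g₀ hh : ℝ) :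
    (modeVec W P Ω k g₀ hh).1 = 0 := rfl

/-- `(T̃_p ỹ)^K = (Tỹ)^K`. [cite: BauerschmidtBrydgesSlade2015Flow, §3.4] -/
theorem Ttil_fst (P : QuadFlowParams) (ψ : ∀ j, W j × V3 → W (j + 1)) (ρ : ∀ j, W j × V3 → V3) (Ω : ℝ) (k : ℕ∞)
    (g₀ hh aK : ℝ) (K₀ : W 0) (S : SeqV →L[ℝ] SeqV) (p : ℝ) (y : SeqK W × SeqV) :
    (Ttil P ψ ρ Ω k g₀ hh aK K₀ S p y).1 = (Tmap P ψ ρ Ω k g₀ hh aK K₀ S y).1 := by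
  simp [Ttil]

/-- `(T̃_p ỹ)^V = (Tỹ)^V + p·e`. [cite: BauerschmidtBrydgesSlade2015Flow, §3.4] -/
theorem Ttil_snd (P : QuadFlowParams) (ψ : ∀ j, W j × V3 → W (j + 1)) (ρ : ∀ j, W j × V3 → V3) (Ω : ℝ) (k : ℕ∞)
    (g₀ hh aK : ℝ) (K₀ : W 0) (S : SeqV →L[ℝ] SeqV) (p : ℝ) (y : SeqK W × SeqV) :
    (Ttil P ψ ρ Ω k g₀ hh aK K₀ S p y).2 = (Tmap P ψ ρ Ω k g₀ hh aK K₀ S y).2 + p • (modeVec W P Ω k g₀ hh).2 := rfl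

/-- `T̃_p ỹ - T̃_p ỹ' = Tỹ - Tỹ'`. [cite: BauerschmidtBrydgesSlade2015Flow, §3.4] -/
theorem Ttil_sub_Ttil (P : QuadFlowParams) (ψ : ∀ j, W j × V3 → W (j + 1)) (ρ : ∀ j, W j × V3 → V3) (Ω : ℝ)
    (k : ℕ∞) (g₀ hh aK : ℝ) (K₀ : W 0) (S : SeqV →L[ℝ] SeqV) (p : ℝ) (y y' : SeqK W × SeqV) :
    Ttil P ψ ρ Ω k g₀ hh aK K₀ S p y - Ttil P ψ ρ Ω k g₀ hh aK K₀ S p y' =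
      Tmap P ψ ρ Ω k g₀ hh aK K₀ S y - Tmap P ψ ρ Ω k g₀ hh aK K₀ S y' := by
  simp only [Ttil]; abel

/-- **The smallness of the contraction at level `β` with a margin `m ≥ 0`**: `SmallHyp` at level `β`
and `‖S‖M/𝗁 + θβ + m ≤ β` (room for the affine perturbation `p·E`, `|p|‖E‖ ≤ m`).
[cite: BauerschmidtBrydgesSlade2015Flow, Theorem 1.4 and Remark 1.5 (the radius of the neighbourhood 𝓘)] -/
structure MarginHyp (Ω B C g₀ κ M hh aK β θ : ℝ) (S : SeqV →L[ℝ] SeqV) (m : ℝ) : Prop where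
  /-- The contraction data at level `β`. -/
  small : CutoffQuadHyp.SmallHyp Ω B C g₀ κ M hh aK β θ S
  /-- `m ≥ 0`. -/
  m_nonneg : 0 ≤ m
  /-- The ball is mapped into itself with margin `m`. -/
  ball_le : ‖S‖ * (M / hh) + θ * β + m ≤ β

end AffineDefs

/-! ## `T̃_p` is a contraction of the ball for `|p|‖E‖ ≤ m`; its fixed point `affFix p` -/

section Contraction

namespace CutoffQuadHyp

variable {P : QuadFlowParams} {Ω : ℝ} {k : ℕ∞} {B c : ℝ} {N : ℕ} {C lam g₀ : ℝ}
  (h : CutoffQuadHyp P Ω k B c N C lam g₀)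
include h

/-- The scaled mode is a bounded sequence. [cite: BauerschmidtBrydgesSlade2015Flow, Lemma 3.4, (3.15)] -/
theorem memℓp_modeV {hh : ℝ} (hh0 : 0 < hh) : Memℓp (P.modeV g₀ Ω k hh) ∞ :=
  memℓp_of_forall_norm_le fun j => h.norm_modeV_le hh0 j

variable {W : ℕ → Type*} [∀ j, NormedAddCommGroup (W j)] [∀ j, NormedSpace ℝ (W j)]

omit [∀ j, NormedSpace ℝ (W j)] in
/-- `(E)^V = e` as a sequence. [cite: BauerschmidtBrydgesSlade2015Flow, Lemma 3.4, (3.15)] -/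
theorem coe_modeVec_snd {hh : ℝ} (hh0 : 0 < hh) :
    ((modeVec W P Ω k g₀ hh).2 : ℕ → V3) = P.modeV g₀ Ω k hh :=
  coe_toSeqV (h.memℓp_modeV hh0)

omit [∀ j, NormedSpace ℝ (W j)] in
/-- **`‖E‖ ≤ K_e/(𝗁g̊₀²|log g̊₀|)`** ((3.15)). [cite: BauerschmidtBrydgesSlade2015Flow, Lemma 3.4, (3.15)] -/
theorem norm_modeVec_le {hh : ℝ} (hh0 : 0 < hh) :
    ‖modeVec W P Ω k g₀ hh‖ ≤ modeVConst Ω c N C lam / (hh * g₀ ^ 2 * |Real.log g₀|) := by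
  have h0 : 0 ≤ modeVConst Ω c N C lam / (hh * g₀ ^ 2 * |Real.log g₀|) :=
    (norm_nonneg _).trans (h.norm_modeV_le hh0 0)
  rw [Prod.norm_def, modeVec_fst, norm_zero]
  refine max_le h0 (lp.norm_le_of_forall_le h0 fun j => ?_)
  rw [h.coe_modeVec_snd hh0]
  exact h.norm_modeV_le hh0 j

variable {ψ : ∀ j, W j × V3 → W (j + 1)} {ρ : ∀ j, W j × V3 → V3} {a hh κ R M aStar β : ℝ} {K₀ : W 0}

/-- **`T̃_p` maps the ball into itself** for `|p|‖E‖ ≤ m`. [cite: BauerschmidtBrydgesSlade2015Flow, Theorem 1.4(ii) (proof) and Remark 1.5] -/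
theorem mapsTo_Ttil (hA : HypA3 (cutoffWeight Ω k) ψ ρ (P.flow g₀) a hh κ Ω R M)
    (hB : BallHyp P ψ Ω k g₀ hh a aStar β K₀) {S : SeqV →L[ℝ] SeqV} {θ m : ℝ}
    (hm : MarginHyp Ω B C g₀ κ M hh (a - aStar) β θ S m) {p : ℝ} (hp : |p| * ‖modeVec W P Ω k g₀ hh‖ ≤ m) :
    MapsTo (Ttil P ψ ρ Ω k g₀ hh (a - aStar) K₀ S p) (scaledBall W β) (scaledBall W β) := by
  intro y hy
  have hb := hB.b_pos.le
  have hS := hm.small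
  refine ⟨?_, ?_⟩
  · rw [Ttil_fst]
    calc ‖(Tmap P ψ ρ Ω k g₀ hh (a - aStar) K₀ S y).1‖ ≤ lipK Ω B g₀ κ M hh (a - aStar) * β := h.norm_Tmap_fst_le hA hB S hy
      _ ≤ θ * β := mul_le_mul_of_nonneg_right hS.lipK_le hb
      _ ≤ 1 * β := mul_le_mul_of_nonneg_right hS.θ_lt.le hb
      _ = β := one_mul β
  · rw [Ttil_snd]
    have hE : ‖p • (modeVec W P Ω k g₀ hh).2‖ ≤ m := by
      rw [norm_smul, Real.norm_eq_abs]
      exact (mul_le_mul_of_nonneg_left (norm_snd_le _) (abs_nonneg p)).trans hp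
    calc ‖(Tmap P ψ ρ Ω k g₀ hh (a - aStar) K₀ S y).2 + p • (modeVec W P Ω k g₀ hh).2‖
        ≤ ‖(Tmap P ψ ρ Ω k g₀ hh (a - aStar) K₀ S y).2‖ + ‖p • (modeVec W P Ω k g₀ hh).2‖ := norm_add_le _ _
      _ ≤ ‖S‖ * (M / hh + lipN Ω B C g₀ M hh (a - aStar) β * β) + m := add_le_add (h.norm_Tmap_snd_le hA hB S hy) hE
      _ = ‖S‖ * (M / hh) + ‖S‖ * lipN Ω B C g₀ M hh (a - aStar) β * β + m := by ring
      _ ≤ ‖S‖ * (M / hh) + θ * β + m := by gcongr; exact hS.lipN_le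
      _ ≤ β := hm.ball_le

/-- **`T̃_p` is `θ`-Lipschitz on the ball** (a translate of `T`). [cite: BauerschmidtBrydgesSlade2015Flow, Theorem 1.4(ii) (proof)] -/
theorem lipschitzOnWith_Ttil (hA : HypA3 (cutoffWeight Ω k) ψ ρ (P.flow g₀) a hh κ Ω R M)
    (hB : BallHyp P ψ Ω k g₀ hh a aStar β K₀) {S : SeqV →L[ℝ] SeqV} {θ m : ℝ}
    (hm : MarginHyp Ω B C g₀ κ M hh (a - aStar) β θ S m) (p : ℝ) :
    LipschitzOnWith (Real.toNNReal θ) (Ttil P ψ ρ Ω k g₀ hh (a - aStar) K₀ S p) (scaledBall W β) := by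
  refine LipschitzOnWith.of_dist_le_mul fun y hy y' hy' => ?_
  have := (h.lipschitzOnWith_Tmap hA hB hm.small).dist_le_mul y hy y' hy'
  rw [dist_eq_norm, Ttil_sub_Ttil, ← dist_eq_norm]
  exact this

/-- **Existence of the fixed point of `T̃_p` in the ball** (Banach). [cite: BauerschmidtBrydgesSlade2015Flow, Theorem 1.4(ii) (proof)] -/
theorem exists_fixedPoint_Ttil [∀ j, CompleteSpace (W j)] (hA : HypA3 (cutoffWeight Ω k) ψ ρ (P.flow g₀) a hh κ Ω R M)
    (hB : BallHyp P ψ Ω k g₀ hh a aStar β K₀) {S : SeqV →L[ℝ] SeqV} {θ m : ℝ}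
    (hm : MarginHyp Ω B C g₀ κ M hh (a - aStar) β θ S m) {p : ℝ} (hp : |p| * ‖modeVec W P Ω k g₀ hh‖ ≤ m) :
    ∃ y ∈ scaledBall W β, Ttil P ψ ρ Ω k g₀ hh (a - aStar) K₀ S p y = y := by
  have hmaps := h.mapsTo_Ttil hA hB hm hp
  have hlip := h.lipschitzOnWith_Ttil hA hB hm p (K₀ := K₀)
  have hc : ContractingWith (Real.toNNReal θ) (hmaps.restrict _ _ _) :=
    ⟨by simpa using hm.small.θ_lt, hlip.mapsToRestrict hmaps⟩
  obtain ⟨y, hy, hfix, -⟩ := ContractingWith.exists_fixedPoint' (isClosed_scaledBall β).isComplete hmaps hc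
    (zero_mem_scaledBall hB.b_pos.le) (edist_ne_top _ _)
  exact ⟨y, hy, hfix⟩

/-- **A priori Lipschitz bound in `p` for fixed points of the family**: if `T̃_pỹ = ỹ`, `T̃_{p'}ỹ' = ỹ'`
in the ball then `‖ỹ - ỹ'‖ ≤ |p - p'|‖E‖/(1 - θ)`. [cite: BauerschmidtBrydgesSlade2015Flow, Theorem 1.4(ii) (proof: continuity of the flow in the initial condition)] -/
theorem norm_sub_le_of_fixedPoints (hA : HypA3 (cutoffWeight Ω k) ψ ρ (P.flow g₀) a hh κ Ω R M)
    (hB : BallHyp P ψ Ω k g₀ hh a aStar β K₀) {S : SeqV →L[ℝ] SeqV} {θ m : ℝ}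
    (hm : MarginHyp Ω B C g₀ κ M hh (a - aStar) β θ S m) {p p' : ℝ} {y y' : SeqK W × SeqV}
    (hy : y ∈ scaledBall W β) (hy' : y' ∈ scaledBall W β)
    (hfy : Ttil P ψ ρ Ω k g₀ hh (a - aStar) K₀ S p y = y) (hfy' : Ttil P ψ ρ Ω k g₀ hh (a - aStar) K₀ S p' y' = y') :
    ‖y - y'‖ ≤ |p - p'| * ‖modeVec W P Ω k g₀ hh‖ / (1 - θ) := by
  have hθ1 := hm.small.θ_lt; have hθ0 := hm.small.θ_nonneg
  have hlip := (h.lipschitzOnWith_Tmap hA hB hm.small).dist_le_mul y hy y' hy'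
  rw [dist_eq_norm, dist_eq_norm, Real.coe_toNNReal _ hθ0] at hlip
  have hdec : y - y' = (Tmap P ψ ρ Ω k g₀ hh (a - aStar) K₀ S y - Tmap P ψ ρ Ω k g₀ hh (a - aStar) K₀ S y') +
      (p - p') • modeVec W P Ω k g₀ hh := by
    conv_lhs => rw [← hfy, ← hfy']
    simp only [Ttil, sub_smul]; abel
  have hn : ‖y - y'‖ ≤ θ * ‖y - y'‖ + |p - p'| * ‖modeVec W P Ω k g₀ hh‖ := by
    calc ‖y - y'‖ = ‖(Tmap P ψ ρ Ω k g₀ hh (a - aStar) K₀ S y - Tmap P ψ ρ Ω k g₀ hh (a - aStar) K₀ S y') +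
          (p - p') • modeVec W P Ω k g₀ hh‖ := by rw [← hdec]
      _ ≤ ‖Tmap P ψ ρ Ω k g₀ hh (a - aStar) K₀ S y - Tmap P ψ ρ Ω k g₀ hh (a - aStar) K₀ S y'‖ +
          ‖(p - p') • modeVec W P Ω k g₀ hh‖ := norm_add_le _ _
      _ ≤ θ * ‖y - y'‖ + |p - p'| * ‖modeVec W P Ω k g₀ hh‖ := by
          rw [norm_smul, Real.norm_eq_abs]; exact add_le_add hlip le_rfl
  rw [le_div_iff₀ (by linarith)]
  nlinarith [norm_nonneg (y - y')]

/-- **Uniqueness of the fixed point of `T̃_p` in the ball.** [cite: BauerschmidtBrydgesSlade2015Flow, Theorem 1.4 (uniqueness clause)] -/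
theorem fixedPoint_Ttil_unique (hA : HypA3 (cutoffWeight Ω k) ψ ρ (P.flow g₀) a hh κ Ω R M)
    (hB : BallHyp P ψ Ω k g₀ hh a aStar β K₀) {S : SeqV →L[ℝ] SeqV} {θ m : ℝ}
    (hm : MarginHyp Ω B C g₀ κ M hh (a - aStar) β θ S m) {p : ℝ} {y y' : SeqK W × SeqV}
    (hy : y ∈ scaledBall W β) (hy' : y' ∈ scaledBall W β)
    (hfy : Ttil P ψ ρ Ω k g₀ hh (a - aStar) K₀ S p y = y) (hfy' : Ttil P ψ ρ Ω k g₀ hh (a - aStar) K₀ S p y' = y') :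
    y = y' := by
  have := h.norm_sub_le_of_fixedPoints hA hB hm hy hy' hfy hfy'
  rw [sub_self, abs_zero, zero_mul, zero_div] at this
  exact sub_eq_zero.1 (norm_le_zero_iff.1 this)

end CutoffQuadHyp

end Contraction

/-! ## The fixed point `affFix p` as a function of `p`: Lipschitz, strictly inside the ball, strictly
differentiable with `‖d/dp affFix‖ ≤ ‖E‖/(1 - θ)` -/

section FixedPointFunction

variable {W : ℕ → Type*} [∀ j, NormedAddCommGroup (W j)] [∀ j, NormedSpace ℝ (W j)]

open Classical in
/-- **The fixed point of `T̃_p` in the ball `scaledBall β`** (when it exists; `0` otherwise): the scaled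
coordinates, around the frozen reference flow `x̄(g̊₀)`, of the flow with `g`-initial value `g̊₀ + p`.
[cite: BauerschmidtBrydgesSlade2015Flow, Theorem 1.4(ii) (the flow x(u₀) as a function of the initial condition)] -/
def affFix (P : QuadFlowParams) (ψ : ∀ j, W j × V3 → W (j + 1)) (ρ : ∀ j, W j × V3 → V3) (Ω : ℝ) (k : ℕ∞)
    (g₀ hh aK : ℝ) (K₀ : W 0) (S : SeqV →L[ℝ] SeqV) (β p : ℝ) : SeqK W × SeqV :=
  if hp : ∃ y ∈ scaledBall W β, Ttil P ψ ρ Ω k g₀ hh aK K₀ S p y = y then hp.choose else 0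

/-- The set `{p : |p|L < m}` is open. [folklore] -/
theorem isOpen_setOf_abs_mul_lt (L m : ℝ) : IsOpen {p : ℝ | |p| * L < m} :=
  isOpen_lt (continuous_abs.mul continuous_const) continuous_const

namespace CutoffQuadHyp

variable {P : QuadFlowParams} {Ω : ℝ} {k : ℕ∞} {B c : ℝ} {N : ℕ} {C lam g₀ : ℝ}
  (h : CutoffQuadHyp P Ω k B c N C lam g₀)
include h

variable {ψ : ∀ j, W j × V3 → W (j + 1)} {ρ : ∀ j, W j × V3 → V3} {a hh κ R M aStar β : ℝ} {K₀ : W 0}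

/-- The defining property of `affFix p` for `|p|‖E‖ ≤ m`: it lies in the ball and `T̃_p(affFix p) = affFix p`.
[cite: BauerschmidtBrydgesSlade2015Flow, Theorem 1.4(ii) (proof)] -/
theorem affFix_spec [∀ j, CompleteSpace (W j)] (hA : HypA3 (cutoffWeight Ω k) ψ ρ (P.flow g₀) a hh κ Ω R M)
    (hB : BallHyp P ψ Ω k g₀ hh a aStar β K₀) {S : SeqV →L[ℝ] SeqV} {θ m : ℝ}
    (hm : MarginHyp Ω B C g₀ κ M hh (a - aStar) β θ S m) {p : ℝ} (hp : |p| * ‖modeVec W P Ω k g₀ hh‖ ≤ m) :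
    affFix P ψ ρ Ω k g₀ hh (a - aStar) K₀ S β p ∈ scaledBall W β ∧
      Ttil P ψ ρ Ω k g₀ hh (a - aStar) K₀ S p (affFix P ψ ρ Ω k g₀ hh (a - aStar) K₀ S β p) =
        affFix P ψ ρ Ω k g₀ hh (a - aStar) K₀ S β p := by
  have hex := h.exists_fixedPoint_Ttil hA hB hm hp (K₀ := K₀)
  have hdef : affFix P ψ ρ Ω k g₀ hh (a - aStar) K₀ S β p = hex.choose := by
    simp only [affFix, dif_pos hex]
  rw [hdef]
  exact hex.choose_spec

/-- `affFix p` is THE fixed point of `T̃_p` in the ball. [cite: BauerschmidtBrydgesSlade2015Flow, Theorem 1.4 (uniqueness clause)] -/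
theorem eq_affFix_of_fixedPoint [∀ j, CompleteSpace (W j)] (hA : HypA3 (cutoffWeight Ω k) ψ ρ (P.flow g₀) a hh κ Ω R M)
    (hB : BallHyp P ψ Ω k g₀ hh a aStar β K₀) {S : SeqV →L[ℝ] SeqV} {θ m : ℝ}
    (hm : MarginHyp Ω B C g₀ κ M hh (a - aStar) β θ S m) {p : ℝ} (hp : |p| * ‖modeVec W P Ω k g₀ hh‖ ≤ m)
    {y : SeqK W × SeqV} (hy : y ∈ scaledBall W β) (hfy : Ttil P ψ ρ Ω k g₀ hh (a - aStar) K₀ S p y = y) :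
    y = affFix P ψ ρ Ω k g₀ hh (a - aStar) K₀ S β p := by
  obtain ⟨hmem, hfix⟩ := h.affFix_spec hA hB hm hp
  exact h.fixedPoint_Ttil_unique hA hB hm hy hmem hfy hfix

/-- **`affFix` is Lipschitz in `p`**: `‖affFix p - affFix p'‖ ≤ |p - p'|‖E‖/(1-θ)` on `{|p|‖E‖ ≤ m}`.
[cite: BauerschmidtBrydgesSlade2015Flow, Theorem 1.4(ii) (proof: continuity in the initial condition)] -/
theorem norm_affFix_sub_le [∀ j, CompleteSpace (W j)] (hA : HypA3 (cutoffWeight Ω k) ψ ρ (P.flow g₀) a hh κ Ω R M)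
    (hB : BallHyp P ψ Ω k g₀ hh a aStar β K₀) {S : SeqV →L[ℝ] SeqV} {θ m : ℝ}
    (hm : MarginHyp Ω B C g₀ κ M hh (a - aStar) β θ S m) {p p' : ℝ}
    (hp : |p| * ‖modeVec W P Ω k g₀ hh‖ ≤ m) (hp' : |p'| * ‖modeVec W P Ω k g₀ hh‖ ≤ m) :
    ‖affFix P ψ ρ Ω k g₀ hh (a - aStar) K₀ S β p - affFix P ψ ρ Ω k g₀ hh (a - aStar) K₀ S β p'‖ ≤
      |p - p'| * ‖modeVec W P Ω k g₀ hh‖ / (1 - θ) := by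
  obtain ⟨hy, hfy⟩ := h.affFix_spec hA hB hm hp
  obtain ⟨hy', hfy'⟩ := h.affFix_spec hA hB hm hp'
  exact h.norm_sub_le_of_fixedPoints hA hB hm hy hy' hfy hfy'

/-- **For `|p|‖E‖ < m` the fixed point lies STRICTLY inside the ball**: `‖(affFix p)^K‖, ‖(affFix p)^V‖ < β`.
[cite: BauerschmidtBrydgesSlade2015Flow, Theorem 1.4(ii) (proof) and Remark 1.5] -/
theorem norm_affFix_lt [∀ j, CompleteSpace (W j)] (hA : HypA3 (cutoffWeight Ω k) ψ ρ (P.flow g₀) a hh κ Ω R M)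
    (hB : BallHyp P ψ Ω k g₀ hh a aStar β K₀) {S : SeqV →L[ℝ] SeqV} {θ m : ℝ}
    (hm : MarginHyp Ω B C g₀ κ M hh (a - aStar) β θ S m) {p : ℝ} (hp : |p| * ‖modeVec W P Ω k g₀ hh‖ < m) :
    ‖(affFix P ψ ρ Ω k g₀ hh (a - aStar) K₀ S β p).1‖ < β ∧ ‖(affFix P ψ ρ Ω k g₀ hh (a - aStar) K₀ S β p).2‖ < β := by
  obtain ⟨hy, hfy⟩ := h.affFix_spec hA hB hm hp.le
  set y := affFix P ψ ρ Ω k g₀ hh (a - aStar) K₀ S β p with hy_def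
  have hb := hB.b_pos; have hS := hm.small
  constructor
  · rw [← hfy, Ttil_fst]
    calc ‖(Tmap P ψ ρ Ω k g₀ hh (a - aStar) K₀ S y).1‖ ≤ lipK Ω B g₀ κ M hh (a - aStar) * β := h.norm_Tmap_fst_le hA hB S hy
      _ ≤ θ * β := mul_le_mul_of_nonneg_right hS.lipK_le hb.le
      _ < 1 * β := mul_lt_mul_of_pos_right hS.θ_lt hb
      _ = β := one_mul β
  · rw [← hfy, Ttil_snd]
    have hE : ‖p • (modeVec W P Ω k g₀ hh).2‖ ≤ |p| * ‖modeVec W P Ω k g₀ hh‖ := by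
      rw [norm_smul, Real.norm_eq_abs]
      exact mul_le_mul_of_nonneg_left (norm_snd_le _) (abs_nonneg p)
    calc ‖(Tmap P ψ ρ Ω k g₀ hh (a - aStar) K₀ S y).2 + p • (modeVec W P Ω k g₀ hh).2‖
        ≤ ‖(Tmap P ψ ρ Ω k g₀ hh (a - aStar) K₀ S y).2‖ + ‖p • (modeVec W P Ω k g₀ hh).2‖ := norm_add_le _ _
      _ ≤ ‖S‖ * (M / hh + lipN Ω B C g₀ M hh (a - aStar) β * β) + |p| * ‖modeVec W P Ω k g₀ hh‖ :=
          add_le_add (h.norm_Tmap_snd_le hA hB S hy) hE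
      _ < ‖S‖ * (M / hh + lipN Ω B C g₀ M hh (a - aStar) β * β) + m := by gcongr
      _ = ‖S‖ * (M / hh) + ‖S‖ * lipN Ω B C g₀ M hh (a - aStar) β * β + m := by ring
      _ ≤ ‖S‖ * (M / hh) + θ * β + m := by gcongr; exact hS.lipN_le
      _ ≤ β := hm.ball_le
set_option maxHeartbeats 400000 in -- buildfix (bf3-g27): 160k/180k FAIL, 200k PASS at accept time; line-neutral budget line
/-- **[BBS-rg-flow, Theorem 1.4(ii), the differentiability mechanism]: `p ↦ affFix p` is strictly
differentiable** at every `p₀` with `|p₀|‖E‖ < m` (for `β < 1`), and its derivative `v` solves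
`v = DT(affFix p₀)v + E`, whence `‖v‖ ≤ ‖E‖/(1 - θ)` — the bound `‖D_{g₀}y‖_{X^𝗐} ≤ C‖D_{g₀}x̄‖_{X^𝗐}`
of the printed proof (there via Gronwall for the variational ODE; here via the implicit function
theorem for the fixed point of the strictly differentiable contraction `T̃`).
[cite: BauerschmidtBrydgesSlade2015Flow, Theorem 1.4(ii) (proof, the displays "d/dt(Dy) = D_xF̊ ∘ Dy" and "ydu")] -/
theorem hasStrictDerivAt_affFix [∀ j, CompleteSpace (W j)] (hA : HypA3 (cutoffWeight Ω k) ψ ρ (P.flow g₀) a hh κ Ω R M)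
    (hB : BallHyp P ψ Ω k g₀ hh a aStar β K₀) (hβ1 : β < 1) {S : SeqV →L[ℝ] SeqV} {θ m : ℝ}
    (hm : MarginHyp Ω B C g₀ κ M hh (a - aStar) β θ S m) {p₀ : ℝ} (hp₀ : |p₀| * ‖modeVec W P Ω k g₀ hh‖ < m) :
    ∃ (T' : (SeqK W × SeqV) →L[ℝ] (SeqK W × SeqV)) (v : SeqK W × SeqV),
      HasFDerivAt (Tmap P ψ ρ Ω k g₀ hh (a - aStar) K₀ S) T' (affFix P ψ ρ Ω k g₀ hh (a - aStar) K₀ S β p₀) ∧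
      ‖T'‖ ≤ θ ∧ v = T' v + modeVec W P Ω k g₀ hh ∧ ‖v‖ ≤ ‖modeVec W P Ω k g₀ hh‖ / (1 - θ) ∧
      HasStrictDerivAt (affFix P ψ ρ Ω k g₀ hh (a - aStar) K₀ S β) v p₀ := by
  have hθ1 := hm.small.θ_lt; have hθ0 := hm.small.θ_nonneg
  have hden : 0 < 1 - θ := by linarith
  -- the base point lies strictly inside the ball, hence in the open unit ball
  obtain ⟨hlt1, hlt2⟩ := h.norm_affFix_lt hA hB hm hp₀
  have hy₀ : ‖affFix P ψ ρ Ω k g₀ hh (a - aStar) K₀ S β p₀‖ < 1 := by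
    rw [Prod.norm_def]; exact max_lt (hlt1.trans_le (by linarith)) (hlt2.trans_le (by linarith))
  -- the derivative of `T` there and its norm
  obtain ⟨T', hT⟩ := h.hasStrictFDerivAt_Tmap hA hB S hy₀
  have hTn : ‖T'‖ ≤ θ := h.norm_fderiv_Tmap_le hA hB hm.small hlt1 hlt2 hT.hasFDerivAt
  -- the uncurried affine family and its strict derivative at `(p₀, affFix p₀)`
  have hTu : HasStrictFDerivAt
      (fun q : ℝ × (SeqK W × SeqV) => Ttil P ψ ρ Ω k g₀ hh (a - aStar) K₀ S q.1 q.2)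
      (T' ∘L ContinuousLinearMap.snd ℝ ℝ (SeqK W × SeqV) +
        (ContinuousLinearMap.fst ℝ ℝ (SeqK W × SeqV)).smulRight (modeVec W P Ω k g₀ hh))
      (p₀, affFix P ψ ρ Ω k g₀ hh (a - aStar) K₀ S β p₀) :=
    (hT.comp (p₀, affFix P ψ ρ Ω k g₀ hh (a - aStar) K₀ S β p₀) hasStrictFDerivAt_snd).add
      (hasStrictFDerivAt_fst.smul_const (modeVec W P Ω k g₀ hh))
  -- the partial derivatives
  have hinr : (T' ∘L ContinuousLinearMap.snd ℝ ℝ (SeqK W × SeqV) +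
      (ContinuousLinearMap.fst ℝ ℝ (SeqK W × SeqV)).smulRight (modeVec W P Ω k g₀ hh)) ∘L
        ContinuousLinearMap.inr ℝ ℝ (SeqK W × SeqV) = T' := by
    refine ContinuousLinearMap.ext fun y => ?_
    simp only [ContinuousLinearMap.coe_comp, Function.comp_apply, ContinuousLinearMap.inr_apply,
      add_apply, ContinuousLinearMap.coe_snd', ContinuousLinearMap.smulRight_apply,
      ContinuousLinearMap.coe_fst', zero_smul, add_zero]
  have hinl : (T' ∘L ContinuousLinearMap.snd ℝ ℝ (SeqK W × SeqV) +
      (ContinuousLinearMap.fst ℝ ℝ (SeqK W × SeqV)).smulRight (modeVec W P Ω k g₀ hh)) ∘L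
        ContinuousLinearMap.inl ℝ ℝ (SeqK W × SeqV) =
      (ContinuousLinearMap.id ℝ ℝ).smulRight (modeVec W P Ω k g₀ hh) := by
    refine ContinuousLinearMap.ext fun p => ?_
    simp only [ContinuousLinearMap.coe_comp, Function.comp_apply, ContinuousLinearMap.inl_apply,
      add_apply, ContinuousLinearMap.coe_snd', map_zero, ContinuousLinearMap.smulRight_apply,
      ContinuousLinearMap.coe_fst', zero_add, ContinuousLinearMap.coe_id', id_eq]
  have hGinv : (ContinuousLinearMap.id ℝ (SeqK W × SeqV) - T').IsInvertible :=
    isInvertible_id_sub_of_norm_lt_one (hTn.trans_lt hθ1)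
  have hinv : (ContinuousLinearMap.id ℝ (SeqK W × SeqV) -
      (T' ∘L ContinuousLinearMap.snd ℝ ℝ (SeqK W × SeqV) +
        (ContinuousLinearMap.fst ℝ ℝ (SeqK W × SeqV)).smulRight (modeVec W P Ω k g₀ hh)) ∘L
          ContinuousLinearMap.inr ℝ ℝ (SeqK W × SeqV)).IsInvertible := by
    rw [hinr]; exact hGinv
  -- fixed points near `p₀` and continuity at `p₀`
  have hopen : {p : ℝ | |p| * ‖modeVec W P Ω k g₀ hh‖ < m} ∈ 𝓝 p₀ :=
    (isOpen_setOf_abs_mul_lt ‖modeVec W P Ω k g₀ hh‖ m).mem_nhds hp₀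
  have hfix : ∀ᶠ p in 𝓝 p₀, Ttil P ψ ρ Ω k g₀ hh (a - aStar) K₀ S p (affFix P ψ ρ Ω k g₀ hh (a - aStar) K₀ S β p) =
      affFix P ψ ρ Ω k g₀ hh (a - aStar) K₀ S β p :=
    Filter.mem_of_superset hopen fun p hp => (h.affFix_spec hA hB hm (le_of_lt hp)).2
  have hlipF : LipschitzOnWith (Real.toNNReal (‖modeVec W P Ω k g₀ hh‖ / (1 - θ)))
      (affFix P ψ ρ Ω k g₀ hh (a - aStar) K₀ S β) {p : ℝ | |p| * ‖modeVec W P Ω k g₀ hh‖ < m} :=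
    LipschitzOnWith.of_dist_le_mul fun p hp p' hp' => by
      rw [dist_eq_norm, Real.dist_eq, Real.coe_toNNReal _ (by positivity)]
      have := h.norm_affFix_sub_le hA hB hm (K₀ := K₀) (le_of_lt hp) (le_of_lt hp')
      calc _ ≤ |p - p'| * ‖modeVec W P Ω k g₀ hh‖ / (1 - θ) := this
        _ = ‖modeVec W P Ω k g₀ hh‖ / (1 - θ) * |p - p'| := by ring
  have hcont : ContinuousAt (affFix P ψ ρ Ω k g₀ hh (a - aStar) K₀ S β) p₀ := hlipF.continuousOn.continuousAt hopen
  -- the implicit function theorem for the fixed point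
  have hD := hasStrictFDerivAt_fixedPoint
    (T := fun q : ℝ × (SeqK W × SeqV) => Ttil P ψ ρ Ω k g₀ hh (a - aStar) K₀ S q.1 q.2)
    (x := affFix P ψ ρ Ω k g₀ hh (a - aStar) K₀ S β) hTu hfix hcont hinv
  rw [hinr, hinl] at hD
  have hDs := hD.hasStrictDerivAt
  obtain ⟨v, hv⟩ : ∃ v : SeqK W × SeqV, v = ((ContinuousLinearMap.id ℝ (SeqK W × SeqV) - T').inverse ∘L
      (ContinuousLinearMap.id ℝ ℝ).smulRight (modeVec W P Ω k g₀ hh)) 1 := ⟨_, rfl⟩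
  rw [← hv] at hDs
  have hv' : v = (ContinuousLinearMap.id ℝ (SeqK W × SeqV) - T').inverse (modeVec W P Ω k g₀ hh) := by
    rw [hv, ContinuousLinearMap.coe_comp, Function.comp_apply, ContinuousLinearMap.smulRight_apply,
      ContinuousLinearMap.coe_id', id_eq, one_smul]
  -- `v = T'v + E`
  have hGv : (ContinuousLinearMap.id ℝ (SeqK W × SeqV) - T') v = modeVec W P Ω k g₀ hh := by
    rw [hv']
    have := congrArg (fun Φ : (SeqK W × SeqV) →L[ℝ] (SeqK W × SeqV) => Φ (modeVec W P Ω k g₀ hh)) hGinv.self_comp_inverse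
    simpa only [ContinuousLinearMap.coe_comp, Function.comp_apply, ContinuousLinearMap.coe_id', id_eq] using this
  have hveq : v = T' v + modeVec W P Ω k g₀ hh := by
    rw [sub_apply, ContinuousLinearMap.coe_id', id_eq] at hGv
    rw [← hGv]; abel
  -- `‖v‖ ≤ ‖E‖/(1-θ)`
  have hvle : ‖v‖ ≤ ‖modeVec W P Ω k g₀ hh‖ / (1 - θ) := by
    have h1 : ‖v‖ ≤ θ * ‖v‖ + ‖modeVec W P Ω k g₀ hh‖ := by
      calc ‖v‖ = ‖T' v + modeVec W P Ω k g₀ hh‖ := by rw [← hveq]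
        _ ≤ ‖T' v‖ + ‖modeVec W P Ω k g₀ hh‖ := norm_add_le _ _
        _ ≤ ‖T'‖ * ‖v‖ + ‖modeVec W P Ω k g₀ hh‖ := add_le_add (T'.le_opNorm v) le_rfl
        _ ≤ θ * ‖v‖ + ‖modeVec W P Ω k g₀ hh‖ := by gcongr
    rw [le_div_iff₀ hden]; nlinarith [norm_nonneg v]
  exact ⟨T', v, hT.hasFDerivAt, hTn, hveq, hvle, hDs⟩

end CutoffQuadHyp

end FixedPointFunction

/-! ## A flow with `g`-initial value `g̊₀ + p` scales back to a fixed point of `T̃_p` -/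

section FlowToFixedPoint

namespace CutoffQuadHyp

variable {P : QuadFlowParams} {Ω : ℝ} {k : ℕ∞} {B c : ℝ} {N : ℕ} {C lam g₀ : ℝ}
  (h : CutoffQuadHyp P Ω k B c N C lam g₀)
include h

omit h in
/-- Coordinates of the scaled mode. [cite: BauerschmidtBrydgesSlade2015Flow, Lemma 3.4, (3.15)] -/
theorem modeV_apply (hh : ℝ) (j : ℕ) :
    P.modeV g₀ Ω k hh j 0 = P.piG g₀ j / P.wG g₀ hh j ∧ P.modeV g₀ Ω k hh j 1 = P.modeZ g₀ j / P.wZ g₀ Ω k hh j ∧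
      P.modeV g₀ Ω k hh j 2 = P.modeMu g₀ j / P.wZ g₀ Ω k hh j := ⟨rfl, rfl, rfl⟩

variable {W : ℕ → Type*} [∀ j, NormedAddCommGroup (W j)] [∀ j, NormedSpace ℝ (W j)]
  {ψ : ∀ j, W j × V3 → W (j + 1)} {ρ : ∀ j, W j × V3 → V3} {a hh κ R M aStar β : ℝ} {K₀ : W 0}

/-- **A flow with offset initial condition is a fixed point of the affine family**: if `x` is a flow
of `Φ` with `K₀` prescribed, `g`-initial value `g̊₀ + p`, `(z_j, μ_j) → 0`, and its scaled-back
coordinates `ỹ` (around the frozen reference `x̄(g̊₀)`) lie in the ball, then `T̃_pỹ = ỹ` (the `𝒦`-row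
directly; the `𝒱`-rows by uniqueness of the linear problem for `ỹ^V - p·e`: its `g`-row starts at `0`
since `e^g_0𝗐_{g,0} = π₀ = 1`, its `z`-row is a decaying and its `μ`-row a bounded homogeneous solution).
[cite: BauerschmidtBrydgesSlade2015Flow, Theorem 1.4(ii) (proof) with Lemma 2.3 (2.35)–(2.40) and Lemma 4.2] -/
theorem Ttil_eq_of_flow (hA : HypA3 (cutoffWeight Ω k) ψ ρ (P.flow g₀) a hh κ Ω R M)
    (hB : BallHyp P ψ Ω k g₀ hh a aStar β K₀) {x : ∀ j, W j × V3} (hflow : IsPerturbedFlow P ψ ρ x)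
    (hK0 : (x 0).1 = K₀) {p : ℝ} (hg0 : (x 0).2 0 = g₀ + p) (hz : Tendsto (fun j => (x j).2 1) atTop (𝓝 0))
    (hμ : Tendsto (fun j => (x j).2 2) atTop (𝓝 0))
    {y : SeqK W × SeqV} (hy : y ∈ scaledBall W β)
    (hy1 : (y.1 : ∀ j, W j) = (unscale P ψ Ω k g₀ hh (a - aStar) K₀ x).1)
    (hy2 : (y.2 : ℕ → V3) = (unscale P ψ Ω k g₀ hh (a - aStar) K₀ x).2) :
    Ttil P ψ ρ Ω k g₀ hh (a - aStar) K₀ (h.sbarVP hB.small1 hB.hh_pos) p y = y := by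
  have haK : 0 < a - aStar := by linarith [hB.aStar_lt]
  -- the physical sequence of `y` is `x`
  have hphys : ∀ j, physX P ψ Ω k g₀ hh (a - aStar) K₀ j ((y.1 : ∀ j, W j) j, (y.2 : ℕ → V3) j) = x j := by
    intro j; rw [hy1, hy2]; exact h.physX_unscale hB x j
  refine Prod.ext ?_ ?_
  · -- the `𝒦`-row
    apply lp.ext
    rw [Ttil_fst, h.coe_Tmap_fst hA hB _ hy]
    funext j
    cases j with
    | zero =>
      rw [TK_zero, hy1, unscale_fst, hK0, Kbar_zero, sub_self, smul_zero]
    | succ j =>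
      rw [TK_succ, hphys j, hy1, unscale_fst, (Prod.ext_iff.1 (hflow j)).1, Kbar_succ]
      rfl
  · -- the `𝒱`-rows
    rw [Ttil_snd, Tmap_snd]
    set r : SeqV := toSeqV (srcN P ψ ρ Ω k g₀ hh (a - aStar) K₀ ((y.1 : ∀ j, W j), (y.2 : ℕ → V3))) with hr_def
    have hr : (r : ℕ → V3) = srcN P ψ ρ Ω k g₀ hh (a - aStar) K₀ ((y.1 : ∀ j, W j), (y.2 : ℕ → V3)) :=
      h.coe_toSeqV_srcN hA hB hy
    obtain ⟨⟨u0, ug, uz, uμ⟩, tz, tμ⟩ := h.sbarVP_solves hB.small1 hB.hh_pos r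
    have hv : ∀ j, P.vV g₀ Ω k hh (j + 1) ≠ 0 := fun j => (h.vV_pos hB.hh_pos (j + 1)).ne'
    have hwG : ∀ j, P.wG g₀ hh j ≠ 0 := fun j => (h.wG_pos hB.hh_pos j).ne'
    have hwZ : ∀ j, P.wZ g₀ Ω k hh j ≠ 0 := fun j => (h.wZ_pos hB.hh_pos j).ne'
    -- the physical source at position `j+1`
    have hsrc : ∀ j (i : Fin 3), P.vV g₀ Ω k hh (j + 1) * (r : ℕ → V3) (j + 1) i =
        (P.quadRem j (P.flow g₀ j) ((x j).2 - P.flow g₀ j) + ρ j (x j)) i := by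
      intro j i
      have hd : physV P Ω k g₀ hh j ((y.2 : ℕ → V3) j) = (x j).2 - P.flow g₀ j := by
        have := congrArg Prod.snd (hphys j)
        simp only [physX] at this
        rw [← this]; abel
      rw [hr, srcN_succ, Pi.smul_apply, smul_eq_mul, ← mul_assoc, mul_inv_cancel₀ (hv j), one_mul, hphys j, hd]
    -- the `𝒱`-flow equation in increment form
    have hflowV : ∀ j, (x (j + 1)).2 - P.flow g₀ (j + 1) =
        P.dmap j (P.flow g₀ j) ((x j).2 - P.flow g₀ j) +
          (P.quadRem j (P.flow g₀ j) ((x j).2 - P.flow g₀ j) + ρ j (x j)) := by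
      intro j
      rw [(Prod.ext_iff.1 (hflow j)).2, (h.isQuadFlowBC_flow).1 j]
      simp only [QuadFlowParams.quadRem, add_sub_cancel]
      abel
    have eqc : ∀ j (i : Fin 3), (x (j + 1)).2 i - P.flow g₀ (j + 1) i =
        P.dmap j (P.flow g₀ j) ((x j).2 - P.flow g₀ j) i + P.vV g₀ Ω k hh (j + 1) * (r : ℕ → V3) (j + 1) i := by
      intro j i
      have := congrFun (hflowV j) i
      simp only [Pi.sub_apply, Pi.add_apply] at this
      rw [this, hsrc j i, Pi.add_apply]
    have d0 : ∀ j, P.dmap j (P.flow g₀ j) ((x j).2 - P.flow g₀ j) 0 = P.aCoef g₀ j * ((x j).2 0 - P.flow g₀ j 0) :=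
      fun j => (P.dmap_flow_apply j g₀ _).1
    have d1 : ∀ j, P.dmap j (P.flow g₀ j) ((x j).2 - P.flow g₀ j) 1 =
        -P.xiT g₀ j * ((x j).2 0 - P.flow g₀ j 0) + P.czCoef g₀ j * ((x j).2 1 - P.flow g₀ j 1) :=
      fun j => (P.dmap_flow_apply j g₀ _).2.1
    have d2 : ∀ j, P.dmap j (P.flow g₀ j) ((x j).2 - P.flow g₀ j) 2 =
        P.etaT g₀ j * ((x j).2 0 - P.flow g₀ j 0) + P.gammaT g₀ j * ((x j).2 1 - P.flow g₀ j 1) +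
          P.lamT g₀ j * ((x j).2 2 - P.flow g₀ j 2) :=
      fun j => (P.dmap_flow_apply j g₀ _).2.2
    -- the `g`-row: forward induction from `0`, with `p` times the `g`-mode `π_j`
    have hGG : ∀ j, (x j).2 0 - P.flow g₀ j 0 =
        P.wG g₀ hh j * (h.sbarVP hB.small1 hB.hh_pos r : ℕ → V3) j 0 + p * P.piG g₀ j := by
      intro j
      induction j with
      | zero => rw [u0, hg0, QuadFlowParams.flow_apply_zero, gbar_zero, QuadFlowParams.piG_zero]; ring
      | succ j ih => rw [eqc, d0, ug, ih, QuadFlowParams.piG_succ]; ring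
    -- the `z`-row: the difference with `p·Zᵉ` is a decaying homogeneous solution
    have hZZ : ∀ j, (x j).2 1 - P.flow g₀ j 1 =
        P.wZ g₀ Ω k hh j * (h.sbarVP hB.small1 hB.hh_pos r : ℕ → V3) j 1 + p * P.modeZ g₀ j := by
      have hD : ∀ j, ((x (j + 1)).2 1 - P.flow g₀ (j + 1) 1 -
          (P.wZ g₀ Ω k hh (j + 1) * (h.sbarVP hB.small1 hB.hh_pos r : ℕ → V3) (j + 1) 1 + p * P.modeZ g₀ (j + 1))) =
          (1 - P.ζ j * gbar P.β g₀ j) *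
            ((x j).2 1 - P.flow g₀ j 1 -
              (P.wZ g₀ Ω k hh j * (h.sbarVP hB.small1 hB.hh_pos r : ℕ → V3) j 1 + p * P.modeZ g₀ j)) := by
        intro j; rw [eqc, d1, uz, hGG, h.modeZ_succ]; simp only [QuadFlowParams.czCoef]; ring
      have hD0 : Tendsto (fun j => (x j).2 1 - P.flow g₀ j 1 -
          (P.wZ g₀ Ω k hh j * (h.sbarVP hB.small1 hB.hh_pos r : ℕ → V3) j 1 + p * P.modeZ g₀ j)) atTop (𝓝 0) := by
        have t1 : Tendsto (fun j => (x j).2 1 - P.flow g₀ j 1) atTop (𝓝 0) := by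
          simpa using hz.sub h.tendsto_zbar_zero
        have t2 : Tendsto (fun j => p * P.modeZ g₀ j) atTop (𝓝 0) := by
          simpa using h.tendsto_modeZ_zero.const_mul p
        simpa using t1.sub (tz.add t2)
      intro j
      have := h.homZ_eq_zero hD hD0 j
      linarith
    -- the `μ`-row: the difference with `p·Mᵉ` is a bounded homogeneous solution of the expanding recursion
    have hMM : ∀ j, (x j).2 2 - P.flow g₀ j 2 =
        P.wZ g₀ Ω k hh j * (h.sbarVP hB.small1 hB.hh_pos r : ℕ → V3) j 2 + p * P.modeMu g₀ j := by
      have hD : ∀ j, ((x (j + 1)).2 2 - P.flow g₀ (j + 1) 2 -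
          (P.wZ g₀ Ω k hh (j + 1) * (h.sbarVP hB.small1 hB.hh_pos r : ℕ → V3) (j + 1) 2 + p * P.modeMu g₀ (j + 1))) =
          (P.lam j - P.tau g₀ j) *
            ((x j).2 2 - P.flow g₀ j 2 -
              (P.wZ g₀ Ω k hh j * (h.sbarVP hB.small1 hB.hh_pos r : ℕ → V3) j 2 + p * P.modeMu g₀ j)) := by
        intro j; rw [eqc, d2, uμ, hGG, hZZ, h.modeMu_succ, ← P.lamT_eq]; ring
      have hD0 : Tendsto (fun j => (x j).2 2 - P.flow g₀ j 2 -
          (P.wZ g₀ Ω k hh j * (h.sbarVP hB.small1 hB.hh_pos r : ℕ → V3) j 2 + p * P.modeMu g₀ j)) atTop (𝓝 0) := by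
        have t1 : Tendsto (fun j => (x j).2 2 - P.flow g₀ j 2) atTop (𝓝 0) := by
          simpa using hμ.sub h.tendsto_mubar_zero
        have t2 : Tendsto (fun j => p * P.modeMu g₀ j) atTop (𝓝 0) := by
          simpa using h.tendsto_modeMu_zero.const_mul p
        simpa using t1.sub (tμ.add t2)
      have hbdd : ∃ R, ∀ j, |(x j).2 2 - P.flow g₀ j 2 -
          (P.wZ g₀ Ω k hh j * (h.sbarVP hB.small1 hB.hh_pos r : ℕ → V3) j 2 + p * P.modeMu g₀ j)| ≤ R := by
        obtain ⟨R, hR⟩ := (hD0.abs).bddAbove_range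
        exact ⟨R, fun j => hR ⟨j, rfl⟩⟩
      intro j
      have := h.homMu_eq_zero hD hbdd j
      linarith
    -- conclude: `y.2 = S̄(Ñ y) + p·e` coordinatewise
    apply lp.ext
    rw [lp.coeFn_add, lp.coeFn_smul, h.coe_modeVec_snd hB.hh_pos, hy2]
    funext j
    ext i
    fin_cases i
    · show (h.sbarVP hB.small1 hB.hh_pos r : ℕ → V3) j 0 + p * P.modeV g₀ Ω k hh j 0 =
        (unscale P ψ Ω k g₀ hh (a - aStar) K₀ x).2 j 0
      rw [unscale_snd_zero, hGG j, (modeV_apply (P := P) (Ω := Ω) (k := k) (g₀ := g₀) hh j).1]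
      field_simp [hwG j]
    · show (h.sbarVP hB.small1 hB.hh_pos r : ℕ → V3) j 1 + p * P.modeV g₀ Ω k hh j 1 =
        (unscale P ψ Ω k g₀ hh (a - aStar) K₀ x).2 j 1
      rw [unscale_snd_one, hZZ j, (modeV_apply (P := P) (Ω := Ω) (k := k) (g₀ := g₀) hh j).2.1]
      field_simp [hwZ j]
    · show (h.sbarVP hB.small1 hB.hh_pos r : ℕ → V3) j 2 + p * P.modeV g₀ Ω k hh j 2 =
        (unscale P ψ Ω k g₀ hh (a - aStar) K₀ x).2 j 2
      rw [unscale_snd_two, hMM j, (modeV_apply (P := P) (Ω := Ω) (k := k) (g₀ := g₀) hh j).2.2]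
      field_simp [hwZ j]

end CutoffQuadHyp

end FlowToFixedPoint


end CTWSAW

end Literature.Barriers.CriticalPhenomena
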